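import Literature.AlgebraicGeometry.Motives.FaltingsAbelianProofs
import Literature.AlgebraicGeometry.Motives.FaltingsAbelianSemisimpleProofs
import Literature.NumberTheory.DiophantineGeometry.AVIsogenyTateEndAlgebraProofs
import Literature.RingTheory.SimpleModule.SemisimpleBaseChange
import HarnessLib

/-!
# Faltings 1983, §5, Sätze 3–4: the semisimplicity input in the printed form `End⁰(A)` semisimple

Third pure-proof sibling of `Literature.AlgebraicGeometry.Motives.FaltingsAbelian` (after
`FaltingsAbelianProofs`, Satz 4, and `FaltingsAbelianSemisimpleProofs`, Satz 3). Those files reduce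
the named facts `faltings_tate_bijective A A ℓ` (Satz 4) and `isSemisimpleRepresentation_rationalTateRep
A ℓ` to Finiteness I, the quotient fact, injectivity of the Tate map, and the hypothesis

  `hss : IsSemisimpleRing E_ℓ(A)`, `E_ℓ(A) = ℚ_ℓ[V_ℓ φ : φ ∈ End_K(A)] ⊆ End_{ℚ_ℓ}(V_ℓ A)`,

inherited from `TateAbelianFiniteEndProofs`. In print this input is **Poincaré's complete
reducibility theorem in the form "`End⁰(A) = ℚ ⊗ End_K(A)` is a (finite-dimensional) semisimple
`ℚ`-algebra"** (Mumford, *Abelian Varieties*, §19, Cor. 2 of Thm. 1, p. 174; Milne, *Abelian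
Varieties* (2008), Ch. IV, proof of Thm. 2.5: "because `E := End(A) ⊗ ℚ` is semisimple, so is
`E ⊗_ℚ ℚ_ℓ`"), a statement about the `ℚ`-algebra `AbelianVariety.endAlgebra A`. This file proves
the passage from that printed statement to `hss`, so that every residual input of the discharge
of hodge.S27 is either a named fact of the tree (`finite_isoClasses_isogenous`,
`exists_quotient_isogeny`, `finiteDimensional_endAlgebra`, `faltingsTateMap_injective`) or the
printed Poincaré corollary `IsSemisimpleRing (endAlgebra A)` itself:

* `isSemisimpleRing_padicTensor_endAlgebra`: `ℚ_ℓ ⊗_ℚ End⁰(A)` is semisimple if `End⁰(A)` is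
  finite-dimensional and semisimple — base change of semisimplicity in characteristic `0`
  (`Literature.RingTheory.SimpleModule.isSemisimpleRing_baseChange`, Pierce 1982 §10.7 Cor. b)
  along `ℚ → ℚ_ℓ`.
* `isSemisimpleRing_adjoin_rationalTateModuleMap_of_endAlgebra`: hence `E_ℓ(A)` is semisimple,
  being the image of `ℚ_ℓ ⊗_ℚ End⁰(A) → End(V_ℓ A)`, `c ⊗ (q ⊗ φ) ↦ c q • V_ℓ φ`
  (`Algebra.TensorProduct.lift`, `RingHom.isSemisimpleRing_of_surjective`).
* The assemblies with the printed hypotheses: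
  `faltings_tate_end_bijective_of_finitenessI_of_endAlgebra` (Satz 4),
  `faltings_tate_bijective_of_finitenessI_of_endAlgebra` (Korollar 1),
  `isSemisimpleRepresentation_rationalTateRep_of_finitenessI_of_endAlgebra` (Satz 3), and the
  finite-field `tate_end_bijective_of_finite_of_endAlgebra` (Tate 1966).

## References

* [Faltings1983Endlichkeit] G. Faltings, Invent. Math. 73 (1983), §5, Sätze 3–4, Korollar 1.
* [MumfordAV1970] D. Mumford, *Abelian Varieties*, §19, Thm. 1 (Poincaré's complete
  reducibility) and Cor. 2, p. 174 (`End⁰(X)` is semisimple). Not held.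
* [MilneAV2008] J. S. Milne, *Abelian Varieties* (2008), Ch. IV, Thm. 2.5 and its proof.
* [Pierce1982] R. S. Pierce, *Associative Algebras*, §10.7 Cor. b (held, read).

## Design

Theorems only; the printed Poincaré input is the hypothesis `IsSemisimpleRing (endAlgebra A)`
(not a new named fact, D-0026), finite-dimensionality is the existing named fact
`finiteDimensional_endAlgebra A`. The ring homomorphism `V_ℓ : End_K(A) → End(V_ℓ A)`, its extensions to
`End⁰(A)` and `ℚ_ℓ ⊗_ℚ End⁰(A)`, and the `ℚ`-algebra structure on `End_{ℚ_ℓ}(V_ℓ A)` (through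
`ℚ → ℚ_ℓ`; Mathlib registers none) are built inside the proofs (`let`/`letI`), so that the file
is a pure-proof proposal.
-/

noncomputable section

universe u

open CategoryTheory CategoryTheory.Limits
open scoped TensorProduct

namespace Literature.AlgebraicGeometry.Motives

open AbelianVariety

variable {K : Type u} [Field K]

section EndAlgebra

variable (A : AbelianVariety K) (ℓ : ℕ) [Fact ℓ.Prime]

/-- **`ℚ_ℓ ⊗_ℚ End⁰(A)` is semisimple if `End⁰(A)` is finite-dimensional and semisimple**
(Milne, *Abelian Varieties* (2008), Ch. IV, proof of Thm. 2.5: "because `E := End(A) ⊗ ℚ` is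
semisimple, `E_ℓ := E ⊗ ℚ_ℓ` is semisimple"; Mumford §19). From the named fact
`finiteDimensional_endAlgebra A` (`hfd`) and Poincaré's corollary `End⁰(A)` semisimple (`hss`,
Mumford §19 Cor. 2 of Thm. 1), by base change of semisimplicity in characteristic zero
(`Literature.RingTheory.SimpleModule.isSemisimpleRing_baseChange`, Pierce 1982 §10.7 Cor. b).
[cite: MilneAV2008, Ch. IV, proof of Thm. 2.5] -/
theorem isSemisimpleRing_padicTensor_endAlgebra (hfd : finiteDimensional_endAlgebra A)
    (hss : IsSemisimpleRing (endAlgebra A)) : IsSemisimpleRing (ℚ_[ℓ] ⊗[ℚ] endAlgebra A) := by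
  haveI : Module.Finite ℚ (endAlgebra A) := hfd
  haveI : IsSemisimpleRing (endAlgebra A) := hss
  exact Literature.RingTheory.SimpleModule.isSemisimpleRing_baseChange ℚ (endAlgebra A) ℚ_[ℓ]

/-- **`E_ℓ(A)` is semisimple if `End⁰(A)` is** (the hypothesis `hss` of
`TateAbelianFiniteEndProofs` from its printed source). For an abelian variety `A` over any field,
a prime `ℓ`, `End⁰(A)` finite-dimensional (`hfd`, named fact `finiteDimensional_endAlgebra A`) and
semisimple (`hss`, Mumford §19 Cor. 2 of Thm. 1): the `ℚ_ℓ`-subalgebra of `End(V_ℓ A)` generated by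
the `V_ℓ φ`, `φ ∈ End_K(A)`, is a semisimple ring — it is the image of the semisimple ring
`ℚ_ℓ ⊗_ℚ End⁰(A)` (`isSemisimpleRing_padicTensor_endAlgebra`) under `c ⊗ (q ⊗ φ) ↦ c q • V_ℓ φ`
(`Algebra.TensorProduct.lift`, twice, of the ring homomorphism `φ ↦ V_ℓ φ`: functoriality
`rationalTateModuleMap_id/_comp/_add`), and quotients of semisimple rings are semisimple
(`RingHom.isSemisimpleRing_of_surjective`). The `ℚ`-algebra structure on `End_{ℚ_ℓ}(V_ℓ A)`
through `ℚ → ℚ_ℓ` is supplied locally. [cite: MilneAV2008, Ch. IV, proof of Thm. 2.5] -/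
theorem isSemisimpleRing_adjoin_rationalTateModuleMap_of_endAlgebra
    (hfd : finiteDimensional_endAlgebra A) (hss : IsSemisimpleRing (endAlgebra A)) :
    IsSemisimpleRing ↥(Algebra.adjoin ℚ_[ℓ] (Set.range fun φ : A ⟶ A ↦
      (rationalTateModuleMap ℓ φ : Module.End ℚ_[ℓ] (A.rationalTateModule ℓ)))) := by
  haveI := isSemisimpleRing_padicTensor_endAlgebra A ℓ hfd hss
  -- `End(V_ℓ A)` as a `ℚ`-algebra through `ℚ → ℚ_ℓ`
  letI iC : Algebra ℚ (Module.End ℚ_[ℓ] (A.rationalTateModule ℓ)) :=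
    ((algebraMap ℚ_[ℓ] (Module.End ℚ_[ℓ] (A.rationalTateModule ℓ))).comp
      (algebraMap ℚ ℚ_[ℓ])).toAlgebra' fun q x ↦ Algebra.commutes (algebraMap ℚ ℚ_[ℓ] q) x
  haveI : IsScalarTower ℚ ℚ_[ℓ] (Module.End ℚ_[ℓ] (A.rationalTateModule ℓ)) :=
    IsScalarTower.of_algebraMap_eq fun _ ↦ rfl
  -- `V_ℓ` as a ring homomorphism `End_K(A) → End(V_ℓ A)`
  let V : End A →+* Module.End ℚ_[ℓ] (A.rationalTateModule ℓ) :=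
    { toFun := fun φ ↦ rationalTateModuleMap ℓ (φ : A ⟶ A)
      map_one' := rationalTateModuleMap_id ℓ A
      map_mul' := fun φ ψ ↦ by
        change rationalTateModuleMap ℓ ((ψ : A ⟶ A) ≫ (φ : A ⟶ A)) =
          rationalTateModuleMap ℓ (φ : A ⟶ A) * rationalTateModuleMap ℓ (ψ : A ⟶ A)
        rw [rationalTateModuleMap_comp]
        rfl
      map_zero' := rationalTateModuleMap_zero ℓ
      map_add' := fun φ ψ ↦ rationalTateModuleMap_add ℓ (φ : A ⟶ A) (ψ : A ⟶ A) }
  -- … and as a `ℤ`-algebra homomorphism (for the `ℤ`-algebra structure of `End A` that the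
  -- tensor product uses; any two ring maps out of `ℤ` agree)
  let Vₐ : End A →ₐ[ℤ] Module.End ℚ_[ℓ] (A.rationalTateModule ℓ) :=
    { V with
      commutes' := fun n ↦ RingHom.congr_fun
        (RingHom.ext_int (V.comp (algebraMap ℤ (End A))) (algebraMap ℤ _)) n }
  -- `q ⊗ φ ↦ q • V_ℓ φ` on `End⁰(A) = ℚ ⊗_ℤ End_K(A)`
  let g : endAlgebra A →ₐ[ℚ] Module.End ℚ_[ℓ] (A.rationalTateModule ℓ) :=
    Algebra.TensorProduct.lift (Algebra.ofId ℚ _) Vₐ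
      fun q φ ↦ Algebra.commute_algebraMap_left q _
  have hg : ∀ (q : ℚ) (φ : End A), g (q ⊗ₜ[ℤ] φ) =
      algebraMap ℚ _ q * rationalTateModuleMap ℓ (φ : A ⟶ A) := fun q φ ↦ by
    change Algebra.TensorProduct.lift _ _ _ (q ⊗ₜ[ℤ] φ) = _
    rw [Algebra.TensorProduct.lift_tmul]
    rfl
  have hgmem : ∀ x : endAlgebra A, g x ∈ Algebra.adjoin ℚ_[ℓ] (Set.range fun φ : A ⟶ A ↦
      (rationalTateModuleMap ℓ φ : Module.End ℚ_[ℓ] (A.rationalTateModule ℓ))) := by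
    intro x
    induction x using TensorProduct.induction_on with
    | zero =>
      show g (0 : endAlgebra A) ∈ _
      rw [map_zero]
      exact zero_mem _
    | tmul q φ =>
      rw [hg]
      exact Subalgebra.mul_mem _ (Subalgebra.algebraMap_mem _ (algebraMap ℚ ℚ_[ℓ] q))
        (Algebra.subset_adjoin ⟨(φ : A ⟶ A), rfl⟩)
    | add x y hx hy =>
      have h := add_mem hx hy
      rw [← map_add] at h
      exact h
  -- `c ⊗ x ↦ c • g x` on `ℚ_ℓ ⊗_ℚ End⁰(A)`
  let Ψ : ℚ_[ℓ] ⊗[ℚ] endAlgebra A →ₐ[ℚ_[ℓ]] Module.End ℚ_[ℓ] (A.rationalTateModule ℓ) :=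
    Algebra.TensorProduct.lift (Algebra.ofId ℚ_[ℓ] _) g
      fun c x ↦ Algebra.commute_algebraMap_left c _
  have hΨ : ∀ (c : ℚ_[ℓ]) (x : endAlgebra A),
      Ψ (c ⊗ₜ[ℚ] x) = algebraMap ℚ_[ℓ] _ c * g x := fun c x ↦ by
    change Algebra.TensorProduct.lift _ _ _ (c ⊗ₜ[ℚ] x) = _
    rw [Algebra.TensorProduct.lift_tmul]
    rfl
  -- its range is `E_ℓ(A)`
  have hrange : Ψ.range = Algebra.adjoin ℚ_[ℓ] (Set.range fun φ : A ⟶ A ↦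
      (rationalTateModuleMap ℓ φ : Module.End ℚ_[ℓ] (A.rationalTateModule ℓ))) := by
    apply le_antisymm
    · intro y hy
      obtain ⟨x, rfl⟩ := (AlgHom.mem_range Ψ).mp hy
      clear hy
      induction x using TensorProduct.induction_on with
      | zero => rw [map_zero]; exact zero_mem _
      | tmul c x =>
        rw [hΨ]
        exact Subalgebra.mul_mem _ (Subalgebra.algebraMap_mem _ c) (hgmem x)
      | add x y hx hy =>
        rw [map_add]
        exact add_mem hx hy
    · refine Algebra.adjoin_le ?_
      rintro _ ⟨φ, rfl⟩
      refine (AlgHom.mem_range Ψ).mpr ⟨(1 : ℚ_[ℓ]) ⊗ₜ[ℚ] (endAlgebra.of A φ), ?_⟩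
      rw [hΨ, map_one, one_mul]
      change g ((1 : ℚ) ⊗ₜ[ℤ] (φ : End A)) = _
      rw [hg, map_one, one_mul]
  rw [← hrange]
  exact RingHom.isSemisimpleRing_of_surjective Ψ.rangeRestrict.toRingHom
    (AlgHom.rangeRestrict_surjective Ψ)

end EndAlgebra

section Assembly

variable (A : AbelianVariety K) (ℓ : ℕ) [Fact ℓ.Prime]

/-- **Faltings 1983, §5, Satz 4, with the semisimplicity input in its printed form.** Grant
Finiteness I and quotients for `A ⊞ A` (`hfin`, `hq`; named facts `finite_isoClasses_isogenous`,
`exists_quotient_isogeny`), `End⁰(A)` finite-dimensional (`hfd`, named fact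
`finiteDimensional_endAlgebra A`) and semisimple (`hss`, Poincaré–Mumford §19 Cor. 2 of Thm. 1),
and injectivity of the Tate map (`hinj`, named fact `faltingsTateMap_injective A A`). Then
`faltings_tate_bijective A A ℓ` (`faltings_tate_end_bijective_of_finitenessI` with
`isSemisimpleRing_adjoin_rationalTateModuleMap_of_endAlgebra`).
[cite: Faltings1983Endlichkeit, §5 Satz 4 (proof)] -/
theorem faltings_tate_end_bijective_of_finitenessI_of_endAlgebra
    (hfin : finite_isoClasses_isogenous (A ⊞ A)) (hq : exists_quotient_isogeny (A ⊞ A) ℓ)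
    (hfd : finiteDimensional_endAlgebra A) (hss : IsSemisimpleRing (endAlgebra A))
    (hinj : faltingsTateMap_injective A A) :
    faltings_tate_bijective A A ℓ :=
  faltings_tate_end_bijective_of_finitenessI A ℓ hfin hq
    (isSemisimpleRing_adjoin_rationalTateModuleMap_of_endAlgebra A ℓ hfd hss) hinj

/-- The same with the two Mumford §19 Thm. 3 inputs (finite-dimensionality of `End⁰(A)` and
injectivity of the Tate map) both supplied from finite generation of `End_K(A)` (named fact
`module_finite_hom A A`; `finiteDimensional_endAlgebra_of_module_finite_hom`,
`faltingsTateMap_injective_of_module_finite_hom`). So `faltings_tate_bijective A A ℓ` follows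
from exactly: Finiteness I (Faltings), quotients (Mumford §7 Thm. 4), `End_K(A)` finitely generated
(Mumford §19 Thm. 3) and `End⁰(A)` semisimple (Poincaré, Mumford §19 Cor. 2 of Thm. 1). [folklore] -/
theorem faltings_tate_end_bijective_of_finitenessI_of_endAlgebra_of_module_finite_hom
    (hfin : finite_isoClasses_isogenous (A ⊞ A)) (hq : exists_quotient_isogeny (A ⊞ A) ℓ)
    (hss : IsSemisimpleRing (endAlgebra A)) (hfg : module_finite_hom A A) :
    faltings_tate_bijective A A ℓ :=
  faltings_tate_end_bijective_of_finitenessI_of_endAlgebra A ℓ hfin hq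
    (finiteDimensional_endAlgebra_of_module_finite_hom A hfg) hss
    (faltingsTateMap_injective_of_module_finite_hom A A hfg)

variable (B : AbelianVariety K) in
/-- **Faltings 1983, §5, Korollar 1, with the printed inputs for `P = A ⊞ B`.**
[cite: Faltings1983Endlichkeit, §5 Korollar 1] -/
theorem faltings_tate_bijective_of_finitenessI_of_endAlgebra
    (hfin : finite_isoClasses_isogenous ((A ⊞ B) ⊞ (A ⊞ B)))
    (hq : exists_quotient_isogeny ((A ⊞ B) ⊞ (A ⊞ B)) ℓ)
    (hfd : finiteDimensional_endAlgebra (A ⊞ B)) (hss : IsSemisimpleRing (endAlgebra (A ⊞ B)))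
    (hinj : faltingsTateMap_injective (A ⊞ B) (A ⊞ B)) :
    faltings_tate_bijective A B ℓ :=
  faltings_tate_bijective_of_end_biprod A B ℓ
    (faltings_tate_end_bijective_of_finitenessI_of_endAlgebra (A ⊞ B) ℓ hfin hq hfd hss hinj)

/-- **Faltings 1983, §5, Satz 3, with the semisimplicity input in its printed form**: Finiteness I
and quotients for `A`, `End⁰(A)` finite-dimensional and semisimple give
`isSemisimpleRepresentation_rationalTateRep A ℓ`
(`isSemisimpleRepresentation_rationalTateRep_of_finitenessI`).
[cite: Faltings1983Endlichkeit, §5 Satz 3 (proof)] -/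
theorem isSemisimpleRepresentation_rationalTateRep_of_finitenessI_of_endAlgebra
    (hfin : finite_isoClasses_isogenous A) (hq : exists_quotient_isogeny A ℓ)
    (hfd : finiteDimensional_endAlgebra A) (hss : IsSemisimpleRing (endAlgebra A)) :
    isSemisimpleRepresentation_rationalTateRep A ℓ :=
  isSemisimpleRepresentation_rationalTateRep_of_finitenessI A ℓ hfin hq
    (isSemisimpleRing_adjoin_rationalTateModuleMap_of_endAlgebra A ℓ hfd hss)

/-- **Tate 1966, Main Theorem (`End` form) over a finite field, with the printed inputs**:
finiteness of `K`-isomorphism classes in dimension `dim (A ⊞ A)` (Milne 1986 Cor. 18.9),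
quotients of `A ⊞ A`, `End⁰(A)` finite-dimensional and semisimple, injectivity of the Tate map
give `tate_end_bijective_of_finite A ℓ` (`tate_end_bijective_of_finite_of_facts`). [folklore] -/
theorem tate_end_bijective_of_finite_of_endAlgebra
    (hfin : finite_isoClasses_of_finite K (A ⊞ A).dim) (hq : exists_quotient_isogeny (A ⊞ A) ℓ)
    (hfd : finiteDimensional_endAlgebra A) (hss : IsSemisimpleRing (endAlgebra A))
    (hinj : faltingsTateMap_injective A A) :
    tate_end_bijective_of_finite A ℓ :=
  tate_end_bijective_of_finite_of_facts ℓ A hfin hq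
    (isSemisimpleRing_adjoin_rationalTateModuleMap_of_endAlgebra A ℓ hfd hss) hinj

end Assembly

end Literature.AlgebraicGeometry.Motives
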